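import Summits.CriticalPhenomena.PercolationContinuityZ3.Theorems.PercNearOneGluingNoHeavyConstsClusterSquareApexHubQuadLinked
import Summits.CriticalPhenomena.PercolationContinuityZ3.Theorems.PercNearOneGluingNoHeavyConstsClusterSquareApexHubLinked
import HarnessLib

/-!
# TS for EVERY triple of an outerplanar graph plus one apex: the apex as a terminal via "no quadruple clash"

builds on p205010 (kernel theorem, internal audit signed; external expert review pending)

PAPER-2 track "percolation constants", part (ii), seat `prim-consts-1`, gen 21 (lane index
`run/shared/lean/prim/consts/CONSTANTS.md`, row A19; memo `FROM-prim-consts-1-g21-APEX-TERMINAL.md`).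
Support file for the crux `NoHeavyLowerTail` (stmt-CriticalPhenomena-4575; `--supports`).  Theorems only; no definitions, no sorries.

THE CLASS (gen 20, `…ConstsClusterSquareApex.lean`): `H` on `Fin n` with an APEX `h`; rim positions `pos`, injective on the rim; (R) rim
edges pairwise non-crossing; (F) no rim edge separates two apex-neighbours — an outerplanar graph plus one vertex drawn inside one
of its faces (all partial wheels, fans, chorded polygons with an interior vertex).  Gen 20 proved CSQ/DUU/TS for RIM terminals via
"no double clash".  With the APEX as a terminal double clashes occur, but (endgame `Consts.Apex.false_of_clash₃` of
`…ApexHubQuadLinked.lean`) never a cross double clash together with a same-side clash; so the QUADRUPLE-clash criterion of gen 18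
(`Consts.clusterSquare_le_sq_of_noQuadClash_pos`) applies at every rim root:
* `Consts.Apex.unlinked₃_hub` — the combinatorial hypothesis of `Consts.not_quadClash_of_unlinked₃` at `(a; b, h)` for all rim `a, b`;
* **`Consts.clusterSquare_le_sq_of_apex_hub`, `Consts.sq_real_split_le_of_apex_hub`** — CSQ and DUU at the rim root `a` with terminals
  `b` (rim) and `h` (apex), for every weight vector supported on `H`, NO sector condition;
* **`Consts.tripleSplit_of_apex_hub`** — TS `μ(a↮b, a↮h, b↮h)² ≤ μ(a↮b) μ(a↮h) μ(b↮h)` for ALL rim `a, b`; concrete `Fin (N+1)` form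
  **`Consts.tripleSplit_apex_hub (N) (w) (hR hF) (a b : Fin N)`**, the companion of `Consts.tripleSplit_apex`.
Together with `Consts.tripleSplit_of_apex` (rim triples): **TS holds for every triple of terminals of every weighted outerplanar graph
plus one apex inside a face** — the chorded-polygon analogue of `…ConstsClusterSquareWheelHub.lean` (partial wheels, all triples).
CSQ/DUU rooted AT THE APEX need the sector condition (`…ConstsClusterSquareApexHub.lean`): quadruple clashes occur there (`W₄` rooted at
the hub, rim terminals antipodal — gen 18's exact reach of the two-copy method).
Census (lane engines g21, exhaustive over ALL (R)+(F) graphs with ≤ 7 rim vertices; kit j204945 at nr = 7: 804 864 graphs): 0 quadruple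
linkages in 253 435 392 rim-rooted clusters (1 031 352 of them doubly linked); at the apex root 44 870 quadruple linkages without (S), 0 with (S).
References: N. Gladkov, arXiv:2408.08457v2 (2024), Def. 4.2, Thm. 4.3, Lemma 3.1, Ex. 2.5, Thm. 5.2, Cor. 5.3; G. Chartrand, F. Harary,
Ann. Inst. H. Poincaré B 3 (1967) 433–438 (outerplanar graphs).
-/

noncomputable section

open Classical

namespace Summit.CriticalPhenomena.PercolationContinuityZ3.Theorems

open MeasureTheory Finset Literature.Probability.LatticeModels Literature.Probability.Percolation

namespace Consts

namespace Apex

variable {n m : ℕ}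

/-! ### No quadruple clash with the apex as a terminal (no sector condition) -/

/-- **No cluster of a rim root `a` carries a cross double linkage to `{b, h}` plus a same-side `b`-clash, when `H` is an outerplanar rim
graph plus one apex `h` inside a face and `b` is on the rim** ((R), (F); NO sector condition): the hypothesis `hK` of
`Consts.not_quadClash_of_unlinked₃` holds at `(a; b, h)`.  (Double linkages do occur here — rim 4-cycle, apex joined to two opposite
corners, `a, b` the other two corners — but never with a third clash vertex.) [folklore: Jordan curve theorem] -/
theorem unlinked₃_hub (H : SimpleGraph (Fin n)) (h : Fin n) (pos : Fin n → Fin m)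
    (hpos : ∀ u v, u ≠ h → v ≠ h → pos u = pos v → u = v)
    (hR : ∀ p q r s : Fin n, p ≠ h → q ≠ h → r ≠ h → s ≠ h → H.Adj p q → H.Adj r s →
      pos p < pos r → pos r < pos q → pos q < pos s → False)
    (hF : ∀ p q u v : Fin n, p ≠ h → q ≠ h → H.Adj p q → H.Adj h u → H.Adj h v →
      pos p < pos u → pos u < pos q → (pos q < pos v ∨ pos v < pos p) → False)
    {a b : Fin n} (ha : a ≠ h) (hb : b ≠ h) :
    ∀ (K : Set (Fin n)) (y y' z : Fin n), a ∈ K → b ∉ K → h ∉ K →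
      (∀ T : Set (Fin n), a ∈ T → (∀ u x, u ∈ T → H.Adj u x → x ∈ K → x ∈ T) → K ⊆ T) →
      y ∉ K → y' ∉ K → z ∉ K → (∃ k, k ∈ K ∧ H.Adj k y) → (∃ k, k ∈ K ∧ H.Adj k y') → (∃ k, k ∈ K ∧ H.Adj k z) →
      y ≠ a → y ≠ b → y ≠ h → y' ≠ a → y' ≠ b → y' ≠ h → y ≠ y' → z ≠ h → z ≠ y → z ≠ y' →
      (∀ (P₁ : H.Walk y b) (P₂ : H.Walk y' h) (W : H.Walk z b), (∀ x ∈ P₁.support, x ∉ K) →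
          (∀ x ∈ P₂.support, x ∉ K) → (∀ x ∈ W.support, x ∉ K) →
          (∃ x, x ∈ P₁.support ∧ x ∈ P₂.support) ∨ (∃ x, x ∈ W.support ∧ x ∈ P₂.support)) ∨
      (∀ (Q₁ : H.Walk y h) (Q₂ : H.Walk y' b) (W : H.Walk z b), (∀ x ∈ Q₁.support, x ∉ K) →
          (∀ x ∈ Q₂.support, x ∉ K) → (∀ x ∈ W.support, x ∉ K) →
          (∃ x, x ∈ Q₁.support ∧ x ∈ Q₂.support) ∨ (∃ x, x ∈ W.support ∧ x ∈ Q₁.support)) := by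
  intro K y y' z haK _ _ hcl _ _ _ hky hk'y' hk₃z _ hyb hyh _ hy'b hy'h hyy' hzh _ _
  obtain ⟨G₀, H', g1, g2, g3, h12, h21⟩ := exists_rim_graphs H h pos hR hF
  have x1 : ∀ p q r s : Fin n, H'.Adj p q → G₀.Adj r s → (pos p - pos a).val < (pos r - pos a).val →
      (pos r - pos a).val < (pos q - pos a).val → (pos q - pos a).val < (pos s - pos a).val → False :=
    fun p q r s hpq hrs => noncross_rot₂ h12 h21 a hpq hrs
  have x2 : ∀ p q r s : Fin n, G₀.Adj p q → H'.Adj r s → (pos p - pos a).val < (pos r - pos a).val →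
      (pos r - pos a).val < (pos q - pos a).val → (pos q - pos a).val < (pos s - pos a).val → False :=
    fun p q r s hpq hrs => noncross_rot₂ h21 h12 a hpq hrs
  obtain ⟨k, hkK, hky⟩ := hky
  obtain ⟨k', hk'K, hk'y'⟩ := hk'y'
  obtain ⟨k₃, hk₃K, hk₃z⟩ := hk₃z
  by_contra hcon
  push Not at hcon
  obtain ⟨⟨P₁, P₂, W₁, hP₁, hP₂, hW₁, hPd, hW₁d⟩, ⟨Q₁, Q₂, W₂, hQ₁, hQ₂, hW₂, hQd, hW₂d⟩⟩ := hcon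
  have hKw := NonCrossing.walks_of_closure haK hcl
  exact false_of_clash₃ hpos g1 g2 g3 x1 x2 ha hKw hb hyh hy'h hzh hkK hky hk'K hk'y' hk₃K hk₃z hyb hy'b hyy'
    P₁ P₂ hP₁ hP₂ hPd W₁ hW₁ hW₁d Q₁ Q₂ hQ₁ hQ₂ hQd W₂ hW₂ hW₂d

end Apex

/-! ### CSQ, DUU, TS with the apex as a terminal — no sector condition -/

section Fin

variable {n m : ℕ} (w : Sym2 (Fin n) → unitInterval) (a b : Fin n) (H : SimpleGraph (Fin n)) (h : Fin n)
  (pos : Fin n → Fin m)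

/-- **CSQ at a rim root `a` with terminals `b` (rim) and the APEX `h`, for EVERY outerplanar rim graph plus one apex inside a face**
((R), (F); no sector condition): `clusterSquare w a b h ≤ μ(b ↮ h)²`, via "no quadruple clash".
[cite: Gladkov2024, Thm. 4.3, Def. 4.2, Lemma 3.1, Ex. 2.5] -/
theorem clusterSquare_le_sq_of_apex_hub (hH : ∀ u v, u ≠ v → (0 : ℝ) < w s(u, v) → H.Adj u v)
    (hpos : ∀ u v, u ≠ h → v ≠ h → pos u = pos v → u = v)
    (hR : ∀ p q r s : Fin n, p ≠ h → q ≠ h → r ≠ h → s ≠ h → H.Adj p q → H.Adj r s →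
      pos p < pos r → pos r < pos q → pos q < pos s → False)
    (hF : ∀ p q u v : Fin n, p ≠ h → q ≠ h → H.Adj p q → H.Adj h u → H.Adj h v →
      pos p < pos u → pos u < pos q → (pos q < pos v ∨ pos v < pos p) → False)
    (ha : a ≠ h) (hb : b ≠ h) :
    clusterSquare w a b h ≤ (prodBernoulli w).real (openConn b h)ᶜ ^ 2 :=
  clusterSquare_le_sq_of_noQuadClash_pos w a b h fun _ _ hω hη hab hac hbc hbc' =>
    not_quadClash_of_unlinked₃ H w hH (Apex.unlinked₃_hub H h pos hpos hR hF ha hb) hω hη hab hac hbc hbc'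

/-- **DUU at a rim root `a` with terminals `b` (rim) and the APEX `h`** (same hypotheses, no sector condition):
`μ(a↮b, a↮h, b↮h)² ≤ μ(a↮b, a↮h) · μ(b↮h)²`. [cite: Gladkov2024, Thm. 5.2 and Thm. 4.3] -/
theorem sq_real_split_le_of_apex_hub (hH : ∀ u v, u ≠ v → (0 : ℝ) < w s(u, v) → H.Adj u v)
    (hpos : ∀ u v, u ≠ h → v ≠ h → pos u = pos v → u = v)
    (hR : ∀ p q r s : Fin n, p ≠ h → q ≠ h → r ≠ h → s ≠ h → H.Adj p q → H.Adj r s →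
      pos p < pos r → pos r < pos q → pos q < pos s → False)
    (hF : ∀ p q u v : Fin n, p ≠ h → q ≠ h → H.Adj p q → H.Adj h u → H.Adj h v →
      pos p < pos u → pos u < pos q → (pos q < pos v ∨ pos v < pos p) → False)
    (ha : a ≠ h) (hb : b ≠ h) :
    (prodBernoulli w).real ((openConn a b)ᶜ ∩ (openConn a h)ᶜ ∩ (openConn b h)ᶜ) ^ 2 ≤
      (prodBernoulli w).real ((openConn a b)ᶜ ∩ (openConn a h)ᶜ) * (prodBernoulli w).real (openConn b h)ᶜ ^ 2 :=
  sq_real_split_le_of_noQuadClash_pos w a b h fun _ _ hω hη hab hac hbc hbc' =>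
    not_quadClash_of_unlinked₃ H w hH (Apex.unlinked₃_hub H h pos hpos hR hF ha hb) hω hη hab hac hbc hbc'

/-- **TS for the triple `{a, b, h}` of ANY two rim vertices and the APEX on an outerplanar rim graph plus one apex inside a face**
((R), (F); no sector condition): `μ(a↮b, a↮h, b↮h)² ≤ μ(a↮b) · μ(a↮h) · μ(b↮h)`.  With `Consts.tripleSplit_of_apex` (rim
triples): **TS for every triple of terminals of every such graph.** [cite: Gladkov2024, Thm. 5.2, Cor. 5.3 (pattern) and Thm. 4.3] -/
theorem tripleSplit_of_apex_hub (hH : ∀ u v, u ≠ v → (0 : ℝ) < w s(u, v) → H.Adj u v)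
    (hpos : ∀ u v, u ≠ h → v ≠ h → pos u = pos v → u = v)
    (hR : ∀ p q r s : Fin n, p ≠ h → q ≠ h → r ≠ h → s ≠ h → H.Adj p q → H.Adj r s →
      pos p < pos r → pos r < pos q → pos q < pos s → False)
    (hF : ∀ p q u v : Fin n, p ≠ h → q ≠ h → H.Adj p q → H.Adj h u → H.Adj h v →
      pos p < pos u → pos u < pos q → (pos q < pos v ∨ pos v < pos p) → False)
    (ha : a ≠ h) (hb : b ≠ h) :
    (prodBernoulli w).real ((openConn a b)ᶜ ∩ (openConn a h)ᶜ ∩ (openConn b h)ᶜ) ^ 2 ≤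
      (prodBernoulli w).real (openConn a b)ᶜ * (prodBernoulli w).real (openConn a h)ᶜ *
        (prodBernoulli w).real (openConn b h)ᶜ :=
  tripleSplit_of_noQuadClash_pos w a b h fun _ _ hω hη hab hac hbc hbc' =>
    not_quadClash_of_unlinked₃ H w hH (Apex.unlinked₃_hub H h pos hpos hR hF ha hb) hω hη hab hac hbc hbc'

end Fin

/-! ### Concrete form: vertices `Fin (N+1)`, apex `Fin.last N`, rim `i.castSucc` in the natural cyclic order -/

/-- **TS with the interior vertex as a terminal for the weighted "polygon with chords plus one interior vertex" graphs on
`Fin (N+1)`** (apex `Fin.last N`, rim `i.castSucc` in the natural cyclic order; `hR`: positive rim–rim pairs non-crossing, `hF`: none of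
them separates two rim vertices positively joined to the apex): for ALL rim `a, b`,
`μ(a↮b, a↮N, b↮N)² ≤ μ(a↮b) μ(a↮N) μ(b↮N)`.  Companion of `Consts.tripleSplit_apex` (rim triples): together, TS for every triple of
terminals — all weighted wheels, fans, chorded polygons with one interior vertex inside a face. [cite: Gladkov2024, Thm. 5.2, Cor. 5.3 (pattern) and Thm. 4.3] -/
theorem tripleSplit_apex_hub (N : ℕ) (w : Sym2 (Fin (N + 1)) → unitInterval)
    (hR : ∀ p q r s : Fin N, (0 : ℝ) < w s(p.castSucc, q.castSucc) → (0 : ℝ) < w s(r.castSucc, s.castSucc) →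
      p < r → r < q → q < s → False)
    (hF : ∀ p q u v : Fin N, (0 : ℝ) < w s(p.castSucc, q.castSucc) → (0 : ℝ) < w s(Fin.last N, u.castSucc) →
      (0 : ℝ) < w s(Fin.last N, v.castSucc) → p < u → u < q → (q < v ∨ v < p) → False)
    (a b : Fin N) :
    (prodBernoulli w).real ((openConn a.castSucc b.castSucc)ᶜ ∩ (openConn a.castSucc (Fin.last N))ᶜ ∩
        (openConn b.castSucc (Fin.last N))ᶜ) ^ 2 ≤
      (prodBernoulli w).real (openConn a.castSucc b.castSucc)ᶜ *
        (prodBernoulli w).real (openConn a.castSucc (Fin.last N))ᶜ *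
        (prodBernoulli w).real (openConn b.castSucc (Fin.last N))ᶜ := by
  let H : SimpleGraph (Fin (N + 1)) := SimpleGraph.fromRel fun u v => (0 : ℝ) < w s(u, v)
  have hH : ∀ u v, u ≠ v → (0 : ℝ) < w s(u, v) → H.Adj u v := fun u v huv hw =>
    (SimpleGraph.fromRel_adj _ u v).2 ⟨huv, Or.inl hw⟩
  have hH' : ∀ u v, H.Adj u v → (0 : ℝ) < w s(u, v) := by
    intro u v huv
    rcases (SimpleGraph.fromRel_adj _ u v).1 huv with ⟨_, e | e⟩
    · exact e
    · rwa [Sym2.eq_swap] at e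
  have hcast : ∀ u : Fin (N + 1), u ≠ Fin.last N → ∃ i : Fin N, u = i.castSucc := fun u hu =>
    ⟨u.castPred hu, (Fin.castSucc_castPred u hu).symm⟩
  let pos : Fin (N + 1) → Fin (N + 1) := id
  refine tripleSplit_of_apex_hub w a.castSucc b.castSucc H (Fin.last N) pos hH (fun u v _ _ e => e)
    ?_ ?_ (Fin.castSucc_lt_last a).ne (Fin.castSucc_lt_last b).ne
  · intro p q r s hp hq hr hs hpq hrs l1 l2 l3
    obtain ⟨p, rfl⟩ := hcast p hp; obtain ⟨q, rfl⟩ := hcast q hq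
    obtain ⟨r, rfl⟩ := hcast r hr; obtain ⟨s, rfl⟩ := hcast s hs
    exact hR p q r s (hH' _ _ hpq) (hH' _ _ hrs) (Fin.castSucc_lt_castSucc_iff.1 l1)
      (Fin.castSucc_lt_castSucc_iff.1 l2) (Fin.castSucc_lt_castSucc_iff.1 l3)
  · intro p q u v hp hq hpq hu hv l1 l2 l3
    obtain ⟨p, rfl⟩ := hcast p hp; obtain ⟨q, rfl⟩ := hcast q hq
    obtain ⟨u, rfl⟩ := hcast u (hu.ne).symm; obtain ⟨v, rfl⟩ := hcast v (hv.ne).symm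
    refine hF p q u v (hH' _ _ hpq) (hH' _ _ hu) (hH' _ _ hv) (Fin.castSucc_lt_castSucc_iff.1 l1)
      (Fin.castSucc_lt_castSucc_iff.1 l2) ?_
    rcases l3 with l3 | l3
    · exact Or.inl (Fin.castSucc_lt_castSucc_iff.1 l3)
    · exact Or.inr (Fin.castSucc_lt_castSucc_iff.1 l3)

end Consts

end Summit.CriticalPhenomena.PercolationContinuityZ3.Theorems
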